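import Summits.Ventures.KdS.ModeStability
import Summits.Ventures.KdS.MasslessScalar
import Literature.Geometry.Lorentzian.KerrDeSitterModeConjugation
import HarnessLib

/-!
# Venture KdS — L5 wiring (PLAN A37 (ii)): the `m < 0` half of Statement B from the `m ≥ 0` half

HONEST FRAMING (venture `Summits/Ventures/KdS`, cell `pub-kds`): bookkeeping over the Literature THEOREM
`isModeSolution_negConj` / `isMasterModeSolution_negConj` of
`Literature/Geometry/Lorentzian/KerrDeSitterModeConjugation.lean` (the symmetry
`σ : (ω, m, λ, R) ↦ (−ω̄, −m, λ̄, conj ∘ R)` of the separated equations for real parameters). If the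
window table is symmetric (`R(−m) = R(m)`, `h0(−m) = h0(m)`, `R0(−m) = R0(m)`) and the λ-families are
conjugation-symmetric in the one direction needed (`λ ∈ Λs ω m`, `m < 0` ⇒ `λ̄ ∈ Λs (−ω̄) (−m)`; the
tile generator DEFINES the `m < 0` rectangles as the conjugate images of the filed `m > 0` ones), then
the λ-truncated "no mode" statements on the `m ≥ 0` half of the certified region imply the full
statements: `noModeWith_of_nonneg` (generic), `statementB_of_nonneg`, `statementBbar_of_nonneg`,
`statementBbarScalar_of_nonneg`, `statementB0_of_nonneg`. So the DATA binders (`R3`-type hypotheses)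
only need the runs with `m ≥ 0`. No claim about mode stability is made here.
-/

noncomputable section

open Set

namespace Summit.Ventures.KdS

open Literature.Geometry.Lorentzian Literature.Geometry.Lorentzian.KerrDeSitter
open scoped ComplexConjugate

/-- One-directional conjugation symmetry of a λ-family: for `m < 0`, `λ ∈ Λs ω m ⇒ λ̄ ∈ Λs (−ω̄) (−m)`. -/
def ConjSymmNeg (Λs : ℂ → ℝ → Set ℂ) : Prop :=
  ∀ (ω : ℂ) (m : ℝ), m < 0 → ∀ lam ∈ Λs ω m, conj lam ∈ Λs (-conj ω) (-m)

/-- A region `W ⊆ ℂ × ℝ` is `σ`-symmetric on its `m < 0` part: `(ω, m) ∈ W`, `m < 0` ⇒ `(−ω̄, −m) ∈ W`. -/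
def NegConjClosed (W : Set (ℂ × ℝ)) : Prop :=
  ∀ (ω : ℂ) (m : ℝ), m < 0 → (ω, m) ∈ W → (-conj ω, -m) ∈ W

/-- **Generic reduction (Teukolsky system, `2s ∈ ℤ`).** "No mode with `λ ∈ Λs`" on the `m ≥ 0` part of a
`σ`-symmetric region implies it on the whole region, for a conjugation-symmetric λ-family. -/
theorem noModeWith_of_nonneg {M a Λ s : ℝ} (hs : ∃ k : ℤ, 2 * s = k) {W : Set (ℂ × ℝ)}
    {Λs : ℂ → ℝ → Set ℂ} (hW : NegConjClosed W) (hΛ : ConjSymmNeg Λs)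
    (h : NoModeWith M a Λ s (W ∩ {q | 0 ≤ q.2}) Λs) : NoModeWith M a Λ s W Λs := by
  intro ω m hq hk lam hlam R hR
  rcases le_or_gt 0 m with hm | hm
  · exact h ω m ⟨hq, hm⟩ hk lam hlam R hR
  · obtain ⟨k, hk⟩ := hk
    obtain ⟨j, hj⟩ := hs
    have hk' : ∃ k' : ℤ, -m - s = k' := ⟨-k - j, by push_cast; linarith⟩
    exact h (-conj ω) (-m) ⟨hW ω m hm hq, by simp only [mem_setOf_eq]; linarith⟩ hk' (conj lam)
      (hΛ ω m hm lam hlam) (fun r => conj (R r)) (isModeSolution_negConj hR)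

/-- **Generic reduction (master system, `2s ∈ ℤ`, any `μ`).** -/
theorem noMasterModeWith_of_nonneg {M a Λ s μ : ℝ} (hs : ∃ k : ℤ, 2 * s = k) {W : Set (ℂ × ℝ)}
    {Λs : ℂ → ℝ → Set ℂ} (hW : NegConjClosed W) (hΛ : ConjSymmNeg Λs)
    (h : NoMasterModeWith M a Λ s μ (W ∩ {q | 0 ≤ q.2}) Λs) : NoMasterModeWith M a Λ s μ W Λs := by
  intro ω m hq hk lam hlam R hR
  rcases le_or_gt 0 m with hm | hm
  · exact h ω m ⟨hq, hm⟩ hk lam hlam R hR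
  · obtain ⟨k, hk⟩ := hk
    obtain ⟨j, hj⟩ := hs
    have hk' : ∃ k' : ℤ, -m - s = k' := ⟨-k - j, by push_cast; linarith⟩
    exact h (-conj ω) (-m) ⟨hW ω m hm hq, by simp only [mem_setOf_eq]; linarith⟩ hk' (conj lam)
      (hΛ ω m hm lam hlam) (fun r => conj (R r)) (isMasterModeSolution_negConj hR)

/-! ### The cell's regions are `σ`-symmetric for symmetric tables -/

/-- `|Re(−ω̄)| = |Re ω|`, `Im(−ω̄) = Im ω`. -/
theorem negConj_re_im (ω : ℂ) : |(-conj ω).re| = |ω.re| ∧ (-conj ω).im = ω.im := by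
  simp [abs_neg]

/-- The certified region (`s = -2`, open in `Im`) is `σ`-symmetric for a symmetric table. -/
theorem negConjClosed_regionCert {T : WindowTable} (hR : ∀ m, T.R (-m) = T.R m) :
    NegConjClosed (regionCert T) := by
  intro ω m _ hq
  obtain ⟨hIm, hM, hre, h0, hH⟩ := hq
  obtain ⟨e1, e2⟩ := negConj_re_im ω
  refine ⟨by rw [e2]; exact hIm, by simpa [abs_neg] using hM, ?_, ?_, ?_⟩
  · show |(-conj ω).re| ≤ T.R (-m); rw [e1, hR]; exact hre
  · show 0 < (-conj ω).im; rw [e2]; exact h0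
  · show (-conj ω).im ≤ T.H; rw [e2]; exact hH

/-- The record region (`s = -2`, closed rectangle) is `σ`-symmetric for a symmetric table. -/
theorem negConjClosed_regionCertBar {T : WindowTable} {η : ℝ} (hR : ∀ m, T.R (-m) = T.R m) :
    NegConjClosed (regionCertBar T η) := by
  intro ω m _ hq
  obtain ⟨hM, hre, hη, hH⟩ := hq
  obtain ⟨e1, e2⟩ := negConj_re_im ω
  refine ⟨by simpa [abs_neg] using hM, ?_, ?_, ?_⟩
  · show |(-conj ω).re| ≤ T.R (-m); rw [e1, hR]; exact hre
  · show -η ≤ (-conj ω).im; rw [e2]; exact hη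
  · show (-conj ω).im ≤ T.H; rw [e2]; exact hH

/-- The scalar record region is `σ`-symmetric for a symmetric table (`R`, `h0` even). -/
theorem negConjClosed_regionCertBarScalar {T : WindowTable} {η : ℝ} (hR : ∀ m, T.R (-m) = T.R m)
    (hh : ∀ m, T.h0 (-m) = T.h0 m) : NegConjClosed (regionCertBarScalar T η) := by
  intro ω m hm hq
  obtain ⟨hM, hm0, hre, hη, hH⟩ := hq
  obtain ⟨e1, e2⟩ := negConj_re_im ω
  refine ⟨by simpa [abs_neg] using hM, by simp only [ne_eq, neg_eq_zero]; exact hm0, ?_, ?_, ?_⟩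
  · show |(-conj ω).re| ≤ T.R (-m); rw [e1, hR]; exact hre
  · show -η ≤ (-conj ω).im; rw [e2]; exact hη
  · show (-conj ω).im ≤ T.h0 (-m); rw [e2, hh]; exact hH

/-- The μ = 0 certified region is `σ`-symmetric for even `R0`. -/
theorem negConjClosed_regionCert0 {M0 : ℝ} {R0 : ℝ → ℝ} (hR : ∀ m, R0 (-m) = R0 m) :
    NegConjClosed (regionCert0 M0 R0) := by
  intro ω m _ hq
  obtain ⟨hIm, hM, hre, h0, hH⟩ := hq
  obtain ⟨e1, e2⟩ := negConj_re_im ω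
  refine ⟨by rw [e2]; exact hIm, by simpa [abs_neg] using hM, ?_, ?_, ?_⟩
  · show |(-conj ω).re| ≤ R0 (-m); rw [e1, hR]; exact hre
  · show 0 < (-conj ω).im; rw [e2]; exact h0
  · show (-conj ω).im ≤ R0 (-m); rw [e2, hR]; exact hH

/-! ### Statement B (and B̄, scalar B̄, B₀) from their `m ≥ 0` halves -/

/-- The `m ≥ 0` half of Statement B̄ (`s = -2`, record wording). -/
def StatementBbarPos (B : Set (ℝ × ℝ × ℝ)) (T : WindowTable) (η : ℝ)
    (Λs : ℝ → ℝ → ℂ → ℝ → Set ℂ) : Prop :=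
  ∀ p ∈ B, NoModeWith p.1 p.2.1 p.2.2 (-2) (regionCertBar T η ∩ {q | 0 ≤ q.2}) (Λs p.2.1 p.2.2)

/-- The `m ≥ 0` half of the scalar Statement B̄ (`s = 0`, `μ = 1`). -/
def StatementBbarScalarPos (B : Set (ℝ × ℝ × ℝ)) (T : WindowTable) (η : ℝ)
    (Λs : ℝ → ℝ → ℂ → ℝ → Set ℂ) : Prop :=
  ∀ p ∈ B, NoModeWith p.1 p.2.1 p.2.2 0 (regionCertBarScalar T η ∩ {q | 0 ≤ q.2}) (Λs p.2.1 p.2.2)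

/-- The `m ≥ 0` half of Statement B₀ (`μ = 0`). -/
def StatementB0Pos (B : Set (ℝ × ℝ × ℝ)) (M0 : ℝ) (R0 : ℝ → ℝ)
    (Λs : ℝ → ℝ → ℂ → ℝ → Set ℂ) : Prop :=
  ∀ p ∈ B, NoMasterModeWith p.1 p.2.1 p.2.2 0 0 (regionCert0 M0 R0 ∩ {q | 0 ≤ q.2}) (Λs p.2.1 p.2.2)

/-- **Statement B (`s = -2`) from its `m ≥ 0` half**, for a symmetric table and conjugation-symmetric
λ-families. -/
theorem statementB_of_nonneg {B : Set (ℝ × ℝ × ℝ)} {T : WindowTable}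
    {Λs : ℝ → ℝ → ℂ → ℝ → Set ℂ} (hR : ∀ m, T.R (-m) = T.R m)
    (hΛ : ∀ a Λ, ConjSymmNeg (Λs a Λ))
    (h : ∀ p ∈ B, NoModeWith p.1 p.2.1 p.2.2 (-2) (regionCert T ∩ {q | 0 ≤ q.2}) (Λs p.2.1 p.2.2)) :
    StatementB B T Λs :=
  fun p hp => noModeWith_of_nonneg ⟨-4, by norm_num⟩ (negConjClosed_regionCert hR) (hΛ _ _) (h p hp)

/-- **Statement B̄ (`s = -2`, record wording) from its `m ≥ 0` half.** -/
theorem statementBbar_of_nonneg {B : Set (ℝ × ℝ × ℝ)} {T : WindowTable} {η : ℝ}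
    {Λs : ℝ → ℝ → ℂ → ℝ → Set ℂ} (hR : ∀ m, T.R (-m) = T.R m)
    (hΛ : ∀ a Λ, ConjSymmNeg (Λs a Λ)) (h : StatementBbarPos B T η Λs) : StatementBbar B T η Λs :=
  fun p hp => noModeWith_of_nonneg ⟨-4, by norm_num⟩ (negConjClosed_regionCertBar hR) (hΛ _ _) (h p hp)

/-- **Scalar Statement B̄ (`s = 0`, `μ = 1`) from its `m ≥ 0` half.** -/
theorem statementBbarScalar_of_nonneg {B : Set (ℝ × ℝ × ℝ)} {T : WindowTable} {η : ℝ}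
    {Λs : ℝ → ℝ → ℂ → ℝ → Set ℂ} (hR : ∀ m, T.R (-m) = T.R m) (hh : ∀ m, T.h0 (-m) = T.h0 m)
    (hΛ : ∀ a Λ, ConjSymmNeg (Λs a Λ)) (h : StatementBbarScalarPos B T η Λs) :
    StatementBbarScalar B T η Λs :=
  fun p hp => noModeWith_of_nonneg ⟨0, by norm_num⟩ (negConjClosed_regionCertBarScalar hR hh) (hΛ _ _)
    (h p hp)

/-- **Statement B₀ (`μ = 0`) from its `m ≥ 0` half.** -/
theorem statementB0_of_nonneg {B : Set (ℝ × ℝ × ℝ)} {M0 : ℝ} {R0 : ℝ → ℝ}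
    {Λs : ℝ → ℝ → ℂ → ℝ → Set ℂ} (hR : ∀ m, R0 (-m) = R0 m) (hΛ : ∀ a Λ, ConjSymmNeg (Λs a Λ))
    (h : StatementB0Pos B M0 R0 Λs) : StatementB0 B M0 R0 Λs :=
  fun p hp => noMasterModeWith_of_nonneg ⟨0, by norm_num⟩ (negConjClosed_regionCert0 hR) (hΛ _ _)
    (h p hp)

/-! ### Symmetrising a λ-family: define the `m < 0` sets as conjugate images -/

/-- Extend a λ-family given for `m ≥ 0` to `m < 0` by conjugate images: for `m < 0`,
`Λsymm Λs ω m := conj '' Λs (−ω̄) (−m)`. -/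
def lamSymm (Λs : ℂ → ℝ → Set ℂ) : ℂ → ℝ → Set ℂ :=
  fun ω m => if m < 0 then (fun z => conj z) '' Λs (-conj ω) (-m) else Λs ω m

/-- The symmetrised family agrees with the given one for `m ≥ 0`. -/
theorem lamSymm_of_nonneg (Λs : ℂ → ℝ → Set ℂ) {m : ℝ} (hm : 0 ≤ m) (ω : ℂ) :
    lamSymm Λs ω m = Λs ω m := by
  simp [lamSymm, not_lt.mpr hm]

/-- The symmetrised family is conjugation-symmetric (in the direction the reduction needs). -/
theorem conjSymmNeg_lamSymm (Λs : ℂ → ℝ → Set ℂ) : ConjSymmNeg (lamSymm Λs) := by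
  intro ω m hm lam hlam
  have hpos : ¬(-m < 0) := by linarith
  simp only [lamSymm, hm, if_true] at hlam
  obtain ⟨z, hz, rfl⟩ := hlam
  simp only [lamSymm, hpos, if_false]
  simpa using hz

/-! ### LIT2's σ-image and transfer forms (HOME/lit/L5-COROLLARY.lean.txt, LIT2 g4 09:52Z, verbatim) -/

/-- **L5 for λ-truncated certificates**: "no mode with `(ω, m) ∈ W`, `λ ∈ Λs ω m`" transfers to the
reflected window `{(−ω̄, −m)}` with the conjugate λ-sets (`2s ∈ ℤ` keeps the admissibility
`m − s ∈ ℤ`). [cite: BertiCardosoStarinets2009, §5.3 (iii)] -/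
theorem noModeWith_negConj {M a Λ s : ℝ} (hs : ∃ k : ℤ, 2 * s = k) {W : Set (ℂ × ℝ)}
    {Λs : ℂ → ℝ → Set ℂ} (h : NoModeWith M a Λ s W Λs) :
    NoModeWith M a Λ s ((fun p : ℂ × ℝ => (-conj p.1, -p.2)) '' W)
      (fun ω m => conj '' Λs (-conj ω) (-m)) := by
  rintro ω' m' hW' ⟨k, hk⟩ lam' ⟨lam, hlam, rfl⟩ R hR
  rw [mem_image_negConj_iff] at hW'
  obtain ⟨j, hj⟩ := hs
  exact h (-conj ω') (-m') hW' ⟨-k - j, by push_cast; linarith⟩ lam hlam (fun r => conj (R r))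
    (by simpa using isModeSolution_negConj hR)

/-- Symmetric-table form: if `W` is invariant under `(ω, m) ↦ (−ω̄, −m)` and the λ-family satisfies
`Λs ω m = conj '' Λs (−ω̄) (−m)`, then `NoModeWith … W Λs` restricted to `m ≥ 0`… — packaged as: the
statement for the reflected data IS the statement for the original data. [cite: BertiCardosoStarinets2009, §5.3 (iii)] -/
theorem noModeWith_of_negConj {M a Λ s : ℝ} (hs : ∃ k : ℤ, 2 * s = k) {W W' : Set (ℂ × ℝ)}
    {Λs Λs' : ℂ → ℝ → Set ℂ} (h : NoModeWith M a Λ s W Λs)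
    (hW : ∀ ω m, (ω, m) ∈ W' → (-conj ω, -m) ∈ W)
    (hΛ : ∀ ω m, (ω, m) ∈ W' → Λs' ω m ⊆ conj '' Λs (-conj ω) (-m)) :
    NoModeWith M a Λ s W' Λs' := by
  intro ω m hW' hk lam hlam R hR
  have h' := noModeWith_negConj hs h
  exact h' ω m ((mem_image_negConj_iff W ω m).2 (hW ω m hW')) hk lam (hΛ ω m hW' hlam) R hR

/-- **L5 for the master system** (any `μ`; `2s ∈ ℤ`). [cite: CasalsTeixeiradacosta2022, Definition 3.4] -/
theorem noMasterModeWith_negConj {M a Λ s μ : ℝ} (hs : ∃ k : ℤ, 2 * s = k) {W : Set (ℂ × ℝ)}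
    {Λs : ℂ → ℝ → Set ℂ} (h : NoMasterModeWith M a Λ s μ W Λs) :
    NoMasterModeWith M a Λ s μ ((fun p : ℂ × ℝ => (-conj p.1, -p.2)) '' W)
      (fun ω m => conj '' Λs (-conj ω) (-m)) := by
  rintro ω' m' hW' ⟨k, hk⟩ lam' ⟨lam, hlam, rfl⟩ R hR
  rw [mem_image_negConj_iff] at hW'
  obtain ⟨j, hj⟩ := hs
  exact h (-conj ω') (-m') hW' ⟨-k - j, by push_cast; linarith⟩ lam hlam (fun r => conj (R r))
    (by simpa using isMasterModeSolution_negConj hR)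

/-- Symmetric-table form for the master system. [cite: CasalsTeixeiradacosta2022, Definition 3.4] -/
theorem noMasterModeWith_of_negConj {M a Λ s μ : ℝ} (hs : ∃ k : ℤ, 2 * s = k) {W W' : Set (ℂ × ℝ)}
    {Λs Λs' : ℂ → ℝ → Set ℂ} (h : NoMasterModeWith M a Λ s μ W Λs)
    (hW : ∀ ω m, (ω, m) ∈ W' → (-conj ω, -m) ∈ W)
    (hΛ : ∀ ω m, (ω, m) ∈ W' → Λs' ω m ⊆ conj '' Λs (-conj ω) (-m)) :
    NoMasterModeWith M a Λ s μ W' Λs' := by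
  intro ω m hW' hk lam hlam R hR
  have h' := noMasterModeWith_negConj hs h
  exact h' ω m ((mem_image_negConj_iff W ω m).2 (hW ω m hW')) hk lam (hΛ ω m hW' hlam) R hR

end Summit.Ventures.KdS

end
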